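import Summits.QuantumFields.YangMills.Theorems.WeakCouplingRatesColdBoxCubic
import Summits.QuantumFields.YangMills.Theorems.WeakCouplingRatesColdBoxChartProduct
import Summits.QuantumFields.YangMills.Theorems.WeakCouplingRates

/-!
# Cruxes `BulkDominatesColdBoxW` (stmt-QuantumFields-19609, interfaces `KernelMeanExpansion`/`KernelCovExpansion`/`FlatCovExpansion`) and
# `ColdBoxTwoPointFloorW` (S3c-ii): brick R3 — the PER-PLAQUETTE chart linearisation of the Wilson cost

For a configuration whose links are all gnomonic chart points `U_e = P(1, v_e)` (`gnomonicChart`, `Theorems/WeakCouplingRatesColdBoxChartProduct.lean`)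
with coordinates `v_e ∈ ℝ³` of Euclidean size `≤ m ≤ 1/4` on the four edges of a plaquette `p = (x; i, j)`, the `SU(2)` Wilson cost of `p` is the
sum over the three colour components of the squared LINEAR circulations up to a cubic error:

  `|plaqCostAt ρ_fund x i j (P(1,v_·)) − Σ_{c<3} (sCirc (v_· c) (x,i,j))²| ≤ 362·m³`     (`abs_plaqCostAt_gnomonic_sub_sum_sq_le`).

Datum-agnostic: the exterior links of a small boundary datum are just more chart links, so the same statement serves the flat wall (19608 S3c)
and the crude-good datum (19609 L1a/L1b).  Ingredients: the holonomy of chart links is `P` of the quaternion product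
`(1+a)(1+b)(1−c)(1−d)` (`quatToSU2_mul_quatToSU2`, `quatToSU2_gnomonicQuat_inv` — reversed links are `−v`), `gnomonicQuat v = 1 + ι(v)` with
`ι(v)` pure imaginary of norm `√(Σ_c v_c²)`, and the cubic lemma `abs_plaquetteCost_sub_sq_norm_le` (seat `ym-wcr-19456-p1`, p447229).

* the chart increment is written `gnomonicQuat v − 1` (pure imaginary): `gnomonicQuat_sub_one_re`, `norm_sq_gnomonicQuat_sub_one` (`= Σ_c v_c²`),
  `norm_gnomonicQuat_sub_one_le`; `plaquetteHolonomyZd_gnomonicChart` (the holonomy as ONE projected quaternion product);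
  `norm_sq_sum_gnomonicQuat_sub_one` (`‖a+b+c+d‖² = Σ_c sCirc²`); the estimate `abs_plaqCostAt_gnomonic_sub_sum_sq_le` and its uniform form
  `…_of_forall` (every link a chart point of size `≤ m`); `plaqCostAt_congr` / `…_of_eq_gnomonic` (only the four links of the plaquette are
  read — the far exterior links of a datum need not be chart points); **`abs_wilsonBoundaryAction_sub_sum_sq_le`** — summed over the
  plaquettes touching an edge set `Λ`: `|S_Λ(U) − Σ_{p touching Λ} Σ_c sCirc(v_· c)(p)²| ≤ 362·m³·#(plaquettesTouching Λ)`.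

Fleet seat `ym-spine-20043-p1` (g3, re-targeted to R2ξ by director-ym LINE №76/№78; line lead `ym-wcr-19609-p1`).  No sorry, standard axioms, no
new definition, no named-fact hypothesis.  NOT a claim about the mass gap.
-/

set_option autoImplicit false

noncomputable section

open Quaternion Finset
open Literature.Probability.LatticeModels
open Literature.MathematicalPhysics.QuantumLattice
open Literature.MathematicalPhysics.QuantumFieldTheory
open Literature.MathematicalPhysics.QuantumFieldTheory.LatticeMaxwell

namespace Summit.QuantumFields.YangMills.Theorems.WeakCouplingRates

/-! ## The chart point as `1 +` a pure imaginary quaternion -/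

/-- `gnomonicQuat v − 1` is pure imaginary. -/
theorem gnomonicQuat_sub_one_re (v : Fin 3 → ℝ) : (gnomonicQuat v - 1).re = 0 := by
  simp [gnomonicQuat]

/-- Components of `gnomonicQuat v − 1`. -/
theorem gnomonicQuat_sub_one_im (v : Fin 3 → ℝ) :
    (gnomonicQuat v - 1).imI = v 0 ∧ (gnomonicQuat v - 1).imJ = v 1 ∧ (gnomonicQuat v - 1).imK = v 2 := by
  simp [gnomonicQuat]

/-- `‖gnomonicQuat v − 1‖² = Σ_c v_c²`. -/
theorem norm_sq_gnomonicQuat_sub_one (v : Fin 3 → ℝ) : ‖gnomonicQuat v - 1‖ ^ 2 = ∑ c, v c ^ 2 := by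
  rw [sq_norm_eq_sum_sq, gnomonicQuat_sub_one_re]
  obtain ⟨h0, h1, h2⟩ := gnomonicQuat_sub_one_im v
  rw [h0, h1, h2, Fin.sum_univ_three]
  ring

/-- `‖gnomonicQuat v − 1‖ ≤ m` whenever `Σ_c v_c² ≤ m²`, `0 ≤ m`. -/
theorem norm_gnomonicQuat_sub_one_le {v : Fin 3 → ℝ} {m : ℝ} (hm : 0 ≤ m) (hv : ∑ c, v c ^ 2 ≤ m ^ 2) :
    ‖gnomonicQuat v - 1‖ ≤ m := by
  have h := norm_sq_gnomonicQuat_sub_one v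
  exact (pow_le_pow_iff_left₀ (norm_nonneg _) hm two_ne_zero).1 (by rw [h]; exact hv)

/-- `Σ_c (−v)_c² = Σ_c v_c²`. -/
theorem sum_sq_neg (v : Fin 3 → ℝ) : ∑ c, (-v) c ^ 2 = ∑ c, v c ^ 2 := by
  simp

/-! ## The holonomy of chart links is one projected quaternion product -/

/-- **Holonomy in the chart**: if the four links of `p = (x; i, j)` are the chart points `P(1, v_e)`, then
`U_p = P((1+a)(1+b)(1+c)(1+d))` with `a = g(v_{x,i}) − 1`, `b = g(v_{x+eᵢ,j}) − 1`, `c = g(−v_{x+eⱼ,i}) − 1`, `d = g(−v_{x,j}) − 1`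
(`g = gnomonicQuat`; reversed links enter with `−v`). -/
theorem plaquetteHolonomyZd_gnomonicChart (v : Literature.MathematicalPhysics.QuantumLattice.ZdEdge 4 → (Fin 3 → ℝ))
    (x : Site 4) (i j : Fin 4) :
    plaquetteHolonomyZd (fun e => gnomonicChart (v e)) x i j =
      quatToSU2 ((1 + (gnomonicQuat (v (x, i)) - 1)) * (1 + (gnomonicQuat (v (x + Pi.single i 1, j)) - 1)) *
        (1 + (gnomonicQuat (-v (x + Pi.single j 1, i)) - 1)) * (1 + (gnomonicQuat (-v (x, j)) - 1))) := by
  simp only [add_sub_cancel]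
  rw [plaquetteHolonomyZd]
  simp only [gnomonicChart]
  rw [quatToSU2_gnomonicQuat_inv, quatToSU2_gnomonicQuat_inv,
    quatToSU2_mul_quatToSU2 (gnomonicQuat_ne_zero _) (gnomonicQuat_ne_zero _),
    quatToSU2_mul_quatToSU2 (mul_ne_zero (gnomonicQuat_ne_zero _) (gnomonicQuat_ne_zero _)) (gnomonicQuat_ne_zero _),
    quatToSU2_mul_quatToSU2 (mul_ne_zero (mul_ne_zero (gnomonicQuat_ne_zero _) (gnomonicQuat_ne_zero _)) (gnomonicQuat_ne_zero _))
      (gnomonicQuat_ne_zero _)]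

/-- **The linear circulation, colour by colour**: `‖a + b + c + d‖² = Σ_{c<3} (sCirc (v_· c) (x,i,j))²` for the four chart increments of
`plaquetteHolonomyZd_gnomonicChart`. -/
theorem norm_sq_sum_gnomonicQuat_sub_one (v : Literature.MathematicalPhysics.QuantumLattice.ZdEdge 4 → (Fin 3 → ℝ))
    (x : Site 4) (i j : Fin 4) :
    ‖(gnomonicQuat (v (x, i)) - 1) + (gnomonicQuat (v (x + Pi.single i 1, j)) - 1) +
        (gnomonicQuat (-v (x + Pi.single j 1, i)) - 1) + (gnomonicQuat (-v (x, j)) - 1)‖ ^ 2 =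
      ∑ c : Fin 3, (sCirc (fun e => v e c) ((x, i, j) : Plaq 4)) ^ 2 := by
  rw [sq_norm_eq_sum_sq, Fin.sum_univ_three]
  simp only [sCirc, gnomonicQuat, Quaternion.re_add, Quaternion.re_sub, Quaternion.imI_add, Quaternion.imI_sub,
    Quaternion.imJ_add, Quaternion.imJ_sub, Quaternion.imK_add, Quaternion.imK_sub, Quaternion.re_one,
    Quaternion.imI_one, Quaternion.imJ_one, Quaternion.imK_one, Pi.neg_apply]
  ring

/-! ## The per-plaquette estimate -/

/-- **R3 — per-plaquette chart linearisation of the `SU(2)` Wilson cost.**  If the four links of the plaquette `(x; i, j)` are chart points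
`P(1, v_e)` with `Σ_c v_{e,c}² ≤ m²` (`0 ≤ m ≤ 1/4`), then
`|plaqCostAt ρ_fund x i j U − Σ_{c<3} (sCirc (v_· c) (x,i,j))²| ≤ 362·m³`. -/
theorem abs_plaqCostAt_gnomonic_sub_sum_sq_le (v : Literature.MathematicalPhysics.QuantumLattice.ZdEdge 4 → (Fin 3 → ℝ))
    (x : Site 4) (i j : Fin 4) {m : ℝ} (hm0 : 0 ≤ m) (hm : m ≤ 1 / 4)
    (h1 : ∑ c, v (x, i) c ^ 2 ≤ m ^ 2) (h2 : ∑ c, v (x + Pi.single i 1, j) c ^ 2 ≤ m ^ 2)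
    (h3 : ∑ c, v (x + Pi.single j 1, i) c ^ 2 ≤ m ^ 2) (h4 : ∑ c, v (x, j) c ^ 2 ≤ m ^ 2) :
    |plaqCostAt (fundamentalRep (Fin 2)) x i j (fun e => gnomonicChart (v e)) -
        ∑ c : Fin 3, (sCirc (fun e => v e c) ((x, i, j) : Plaq 4)) ^ 2| ≤ 362 * m ^ 3 := by
  have hcost : plaqCostAt (fundamentalRep (Fin 2)) x i j (fun e => gnomonicChart (v e)) =
      2 - (((plaquetteHolonomyZd (fun e => gnomonicChart (v e)) x i j : Matrix.specialUnitaryGroup (Fin 2) ℂ) :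
        Matrix (Fin 2) (Fin 2) ℂ).trace).re := by
    simp only [plaqCostAt, plaquetteObs, Nat.cast_ofNat]
    rfl
  rw [hcost, plaquetteHolonomyZd_gnomonicChart, ← norm_sq_sum_gnomonicQuat_sub_one]
  exact abs_plaquetteCost_sub_sq_norm_le (gnomonicQuat_sub_one_re _) (gnomonicQuat_sub_one_re _) (gnomonicQuat_sub_one_re _)
    (gnomonicQuat_sub_one_re _) hm (norm_gnomonicQuat_sub_one_le hm0 h1) (norm_gnomonicQuat_sub_one_le hm0 h2)
    (norm_gnomonicQuat_sub_one_le hm0 (by rw [sum_sq_neg]; exact h3)) (norm_gnomonicQuat_sub_one_le hm0 (by rw [sum_sq_neg]; exact h4))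

/-- **R3, uniform form**: if EVERY link is a chart point of size `≤ m` (`0 ≤ m ≤ 1/4`), the estimate holds at every plaquette. -/
theorem abs_plaqCostAt_gnomonic_sub_sum_sq_le_of_forall (v : Literature.MathematicalPhysics.QuantumLattice.ZdEdge 4 → (Fin 3 → ℝ))
    {m : ℝ} (hm0 : 0 ≤ m) (hm : m ≤ 1 / 4) (hv : ∀ e, ∑ c, v e c ^ 2 ≤ m ^ 2) (x : Site 4) (i j : Fin 4) :
    |plaqCostAt (fundamentalRep (Fin 2)) x i j (fun e => gnomonicChart (v e)) -
        ∑ c : Fin 3, (sCirc (fun e => v e c) ((x, i, j) : Plaq 4)) ^ 2| ≤ 362 * m ^ 3 :=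
  abs_plaqCostAt_gnomonic_sub_sum_sq_le v x i j hm0 hm (hv _) (hv _) (hv _) (hv _)

/-! ## Configurations that are chart points only ON THE RELEVANT EDGES, and the boundary Wilson action -/

/-- The plaquette cost only reads the four links of the plaquette. -/
theorem plaqCostAt_congr {G : Type*} [Group G] {N : ℕ} (ρ : G →* Matrix (Fin N) (Fin N) ℂ) (x : Site 4) (i j : Fin 4)
    {U U' : LGConfig 4 G} (h1 : U (x, i) = U' (x, i)) (h2 : U (x + Pi.single i 1, j) = U' (x + Pi.single i 1, j))
    (h3 : U (x + Pi.single j 1, i) = U' (x + Pi.single j 1, i)) (h4 : U (x, j) = U' (x, j)) :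
    plaqCostAt ρ x i j U = plaqCostAt ρ x i j U' := by
  simp only [plaqCostAt, plaquetteObs, plaquetteHolonomyZd, h1, h2, h3, h4]

/-- **R3 for a configuration that agrees with chart points on the four edges of the plaquette** (the exterior links of the one-scale
expansion are a boundary datum, chart points only near the box): same estimate. -/
theorem abs_plaqCostAt_sub_sum_sq_le_of_eq_gnomonic (U : LGConfig 4 (Matrix.specialUnitaryGroup (Fin 2) ℂ))
    (v : Literature.MathematicalPhysics.QuantumLattice.ZdEdge 4 → (Fin 3 → ℝ)) (x : Site 4) (i j : Fin 4) {m : ℝ} (hm0 : 0 ≤ m) (hm : m ≤ 1 / 4)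
    (hU1 : U (x, i) = gnomonicChart (v (x, i))) (hU2 : U (x + Pi.single i 1, j) = gnomonicChart (v (x + Pi.single i 1, j)))
    (hU3 : U (x + Pi.single j 1, i) = gnomonicChart (v (x + Pi.single j 1, i))) (hU4 : U (x, j) = gnomonicChart (v (x, j)))
    (h1 : ∑ c, v (x, i) c ^ 2 ≤ m ^ 2) (h2 : ∑ c, v (x + Pi.single i 1, j) c ^ 2 ≤ m ^ 2)
    (h3 : ∑ c, v (x + Pi.single j 1, i) c ^ 2 ≤ m ^ 2) (h4 : ∑ c, v (x, j) c ^ 2 ≤ m ^ 2) :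
    |plaqCostAt (fundamentalRep (Fin 2)) x i j U - ∑ c : Fin 3, (sCirc (fun e => v e c) ((x, i, j) : Plaq 4)) ^ 2| ≤ 362 * m ^ 3 := by
  rw [plaqCostAt_congr (fundamentalRep (Fin 2)) x i j (U' := fun e => gnomonicChart (v e)) hU1 hU2 hU3 hU4]
  exact abs_plaqCostAt_gnomonic_sub_sum_sq_le v x i j hm0 hm h1 h2 h3 h4

/-- **R3 summed over the plaquettes touching an edge set** (the boundary Wilson action of the DLR kernel): if `U` agrees with chart points
`P(1, v_e)` of size `≤ m ≤ 1/4` on every edge of every plaquette touching `Λ`, then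
`|wilsonBoundaryAction ρ_fund Λ U − Σ_{p touching Λ} Σ_{c<3} sCirc(v_· c)(p)²| ≤ 362·m³·#(plaquettesTouching Λ)`. -/
theorem abs_wilsonBoundaryAction_sub_sum_sq_le (U : LGConfig 4 (Matrix.specialUnitaryGroup (Fin 2) ℂ))
    (v : Literature.MathematicalPhysics.QuantumLattice.ZdEdge 4 → (Fin 3 → ℝ))
    (Λ : Finset (Literature.MathematicalPhysics.QuantumLattice.ZdEdge 4)) {m : ℝ} (hm0 : 0 ≤ m) (hm : m ≤ 1 / 4)
    (hU : ∀ p ∈ plaquettesTouching Λ, ∀ e ∈ plaquetteEdges p, U e = gnomonicChart (v e))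
    (hv : ∀ p ∈ plaquettesTouching Λ, ∀ e ∈ plaquetteEdges p, ∑ c, v e c ^ 2 ≤ m ^ 2) :
    |wilsonBoundaryAction (fundamentalRep (Fin 2)) Λ U -
        ∑ p ∈ plaquettesTouching Λ, ∑ c : Fin 3, (sCirc (fun e => v e c) ((p.1, p.2.1.1, p.2.1.2) : Plaq 4)) ^ 2| ≤
      362 * m ^ 3 * #(plaquettesTouching Λ) := by
  have hterm : ∀ p ∈ plaquettesTouching Λ,
      |plaqCostAt (fundamentalRep (Fin 2)) p.1 p.2.1.1 p.2.1.2 U -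
          ∑ c : Fin 3, (sCirc (fun e => v e c) ((p.1, p.2.1.1, p.2.1.2) : Plaq 4)) ^ 2| ≤ 362 * m ^ 3 := by
    intro p hp
    have he : ∀ e ∈ plaquetteEdges p, U e = gnomonicChart (v e) := hU p hp
    have hs : ∀ e ∈ plaquetteEdges p, ∑ c, v e c ^ 2 ≤ m ^ 2 := hv p hp
    have m1 : (p.1, p.2.1.1) ∈ plaquetteEdges p := by simp [plaquetteEdges]
    have m2 : (p.1 + Pi.single p.2.1.1 1, p.2.1.2) ∈ plaquetteEdges p := by simp [plaquetteEdges]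
    have m3 : (p.1 + Pi.single p.2.1.2 1, p.2.1.1) ∈ plaquetteEdges p := by simp [plaquetteEdges]
    have m4 : (p.1, p.2.1.2) ∈ plaquetteEdges p := by simp [plaquetteEdges]
    exact abs_plaqCostAt_sub_sum_sq_le_of_eq_gnomonic U v p.1 p.2.1.1 p.2.1.2 hm0 hm (he _ m1) (he _ m2) (he _ m3) (he _ m4)
      (hs _ m1) (hs _ m2) (hs _ m3) (hs _ m4)
  have hW : wilsonBoundaryAction (fundamentalRep (Fin 2)) Λ U = ∑ p ∈ plaquettesTouching Λ, plaqCostAt (fundamentalRep (Fin 2)) p.1 p.2.1.1 p.2.1.2 U := rfl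
  rw [hW, ← Finset.sum_sub_distrib]
  refine (Finset.abs_sum_le_sum_abs _ _).trans ?_
  refine (Finset.sum_le_card_nsmul _ _ _ hterm).trans (le_of_eq ?_)
  rw [nsmul_eq_mul]; ring

end Summit.QuantumFields.YangMills.Theorems.WeakCouplingRates

end
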